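import Mathlib
import HarnessLib
import Summits.NavierStokesRegularity.NavierStokesRegularity.Theses.PoloidalWindowDoor
import Summits.NavierStokesRegularity.NavierStokesRegularity.Theorems.PoloidalWindowDoorLocalPointZoomSlices
import Summits.NavierStokesRegularity.NavierStokesRegularity.Theorems.PoloidalWindowDoorPoloidalWindowRigidity

/-!
# Route `PoloidalWindowDoor` — `Assembly` is a THEOREM and the leaf `Target` (rung N0-LocalTubeDoorPoloidal) is
# REDUCED to the one open stub `stub_nonflatLiouville` of the K2 birth skeleton

Cell ns-regularity-ideate, seat p6. The gate-certified deciding theorem `Theses.PoloidalWindowDoor.closes :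
LocalPointZoomSlices → PoloidalWindowRigidity → Target` (nsreg-p1, scale-critical limit passage) composes the tree
theorem K1 (`…PoloidalWindowDoorLocalPointZoomSlices.localPointZoomSlices_proof`) with the K2 reduction
(`…PoloidalWindowDoorPoloidalWindowRigidity.poloidalWindowRigidity_of_nonflatLiouville`):

* `assembly_proof : …Theses.PoloidalWindowDoor.Assembly`;
* `poloidalWindowRigidity_of_nonflatLiouville' : <stub_nonflatLiouville signature> → …Theses.PoloidalWindowDoor.PoloidalWindowRigidity`;
* `target_of_nonflatLiouville : <stub_nonflatLiouville signature> → …Theses.PoloidalWindowDoor.Target`.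

WHAT THIS IS NOT: not a claim about Navier–Stokes regularity and not a proof of the leaf — the leaf is a regularity
CRITERION and is here proved CONDITIONALLY on the declared open residue of K2 (rigidity of non-flat poloidal Type-I
profiles); establishment in the cell's sense further requires the cross-family referee PASS + independent reproduction.
-/

noncomputable section

-- the summit and its single sub-problem share the name (CONVENTIONS §1), as in every Theorems file
set_option linter.dupNamespace false

namespace Summit.NavierStokesRegularity.NavierStokesRegularity.Theorems.PoloidalWindowDoorTarget

open scoped RealInnerProductSpace InnerProductSpace
open Summit.NavierStokesRegularity.NavierStokesRegularity.Theses.PoloidalWindowDoor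
open Summit.NavierStokesRegularity.NavierStokesRegularity.Theorems.PoloidalWindowDoorLocalPointZoomSlices
open Summit.NavierStokesRegularity.NavierStokesRegularity.Theorems.PoloidalWindowDoorPoloidalWindowRigidity

/-- **The route's `Assembly` item**: `LocalPointZoomSlices → PoloidalWindowRigidity → Target`, by the gate-certified
deciding theorem `closes` of the route file. -/
theorem assembly_proof :
    Summit.NavierStokesRegularity.NavierStokesRegularity.Theses.PoloidalWindowDoor.Assembly :=
  fun h₁ h₂ => closes h₁ h₂

/-- **K2 BY NAME modulo its open stub**: the Theses decl `PoloidalWindowRigidity` follows from the statement of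
`stub_nonflatLiouville` (the composition file's `poloidalWindowRigidity_of_nonflatLiouville`, re-typed against the born decl). -/
theorem poloidalWindowRigidity_of_nonflatLiouville'
    (h₅ : ∀ (C : ℝ) (v : ℝ → EuclideanSpace ℝ (Fin 3) → EuclideanSpace ℝ (Fin 3)),
      Literature.Analysis.FluidPDE.HasTypeITimeDecay C v →
      ContinuousOn (Function.uncurry v) (Set.Iio (0 : ℝ) ×ˢ Set.univ) →
      (∀ s t : ℝ, s < t → t < 0 → ∀ x, v t x =
        Literature.Analysis.UnboundedOperators.heatExtension (v s) (t - s) x -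
          Literature.Analysis.FluidPDE.oseenDuhamel 1 s v v t x) →
      (∀ t < 0, Literature.Analysis.FluidPDE.VectorCalculus.IsDivFree (v t)) →
      (∀ s < 0, ∀ y, ⟪Literature.Analysis.FluidPDE.curl (v s) y, EuclideanSpace.single 2 1⟫_ℝ = 0) →
      (∀ s < 0, ∀ y, ⟪fderiv ℝ (v s) y (Literature.Analysis.FluidPDE.curl (v s) y), EuclideanSpace.single 2 1⟫_ℝ = 0) →
      (∃ s < 0, ∃ y, fderiv ℝ (v s) y (EuclideanSpace.single 0 1) 2 ≠ 0) →
      ¬ Literature.Analysis.FluidPDE.IsBackwardSingularPoint v 0) :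
    Summit.NavierStokesRegularity.NavierStokesRegularity.Theses.PoloidalWindowDoor.PoloidalWindowRigidity := by
  unfold Summit.NavierStokesRegularity.NavierStokesRegularity.Theses.PoloidalWindowDoor.PoloidalWindowRigidity
  exact poloidalWindowRigidity_of_nonflatLiouville h₅

/-- **The leaf N0-LocalTubeDoorPoloidal modulo the open stub**: `Target` follows from the statement of
`stub_nonflatLiouville` — `closes` applied to the tree theorem K1 and to K2-modulo-the-stub. -/
theorem target_of_nonflatLiouville
    (h₅ : ∀ (C : ℝ) (v : ℝ → EuclideanSpace ℝ (Fin 3) → EuclideanSpace ℝ (Fin 3)),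
      Literature.Analysis.FluidPDE.HasTypeITimeDecay C v →
      ContinuousOn (Function.uncurry v) (Set.Iio (0 : ℝ) ×ˢ Set.univ) →
      (∀ s t : ℝ, s < t → t < 0 → ∀ x, v t x =
        Literature.Analysis.UnboundedOperators.heatExtension (v s) (t - s) x -
          Literature.Analysis.FluidPDE.oseenDuhamel 1 s v v t x) →
      (∀ t < 0, Literature.Analysis.FluidPDE.VectorCalculus.IsDivFree (v t)) →
      (∀ s < 0, ∀ y, ⟪Literature.Analysis.FluidPDE.curl (v s) y, EuclideanSpace.single 2 1⟫_ℝ = 0) →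
      (∀ s < 0, ∀ y, ⟪fderiv ℝ (v s) y (Literature.Analysis.FluidPDE.curl (v s) y), EuclideanSpace.single 2 1⟫_ℝ = 0) →
      (∃ s < 0, ∃ y, fderiv ℝ (v s) y (EuclideanSpace.single 0 1) 2 ≠ 0) →
      ¬ Literature.Analysis.FluidPDE.IsBackwardSingularPoint v 0) :
    Summit.NavierStokesRegularity.NavierStokesRegularity.Theses.PoloidalWindowDoor.Target :=
  closes localPointZoomSlices_proof (poloidalWindowRigidity_of_nonflatLiouville' h₅)

end Summit.NavierStokesRegularity.NavierStokesRegularity.Theorems.PoloidalWindowDoorTarget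

end
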